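import Summits.ValiantsHypothesis.ValiantsHypothesis.Theorems.LacunarySymmetroidMatrixDescartesFiniteSectorStampCeilingKThree

/-!
# `MatrixDescartes` — line «finite»: STÖHR'S CEILING for the whole `K = 3` column (kernel, all `m`):
# `ν(m,3) ≤ ⌊(m² + 6m + 1)/4⌋ = n(m,2)`, i.e. `StampLawAt m 3 ((m^2 + 6m + 1)/4)` for every `m ≥ 1`

HONEST FRAMING.  Object-search cell `pub-symmetroid`, seat val-sym-eng-3 g4.  HELPER of the crux item `stmt-ValiantsHypothesis-18050`
(`Theses.LacunarySymmetroid.MatrixDescartes`, asymptotic in `K`) with NO closure claim.  `…FiniteSectorStampCeilingKThree` reduced the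
`K = 3` stamp ceiling to a two-denomination postage-stamp bound (`stampLawAt_three_of_stamps`: with three exponents the values are
`{0, 1, x}`, every `m`-fold sum is `p + q·x` with `p + q ≤ m`) and checked the rows `m = 2, …, 7` numerically.  This file proves the bound
in CLOSED FORM for every `m`: with stamps `{1, x}` and at most `m` of them, the value `x·(m + 3 − x) − 1` is never representable
(`1 ≤ x ≤ m + 2`; for `x = 0` or `x ≥ m + 3` already `m + 1` is not), and `4·(x(m+3−x) − 1) ≤ (m+3)² − 4`; hence every covered initial
segment `[0, N]` has `4N ≤ m² + 6m + 1`, i.e. `N ≤ n(m,2) = ⌊(m²+6m+1)/4⌋` (Stöhr 1955; the bound is attained by `x = ⌊(m+3)/2⌋`, not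
needed here).  Consequence: `stampLawAt_K_three : StampLawAt m 3 ((m^2 + 6*m + 1)/4)` for all `m ≥ 1` — the rows `ν(3,3) ≤ 7`,
`ν(4,3) ≤ 10`, `ν(5,3) ≤ 14`, `ν(6,3) ≤ 18`, `ν(7,3) ≤ 23`, `ν(8,3) ≤ 28`, … uniformly.  Nothing here bears on the crux or on `VP ≠ VNP`.
[folklore] Two-denomination postage-stamp problem (Stöhr, «Gelöste und ungelöste Fragen über Basen der natürlichen Zahlenreihe», 1955:
`n(h,2) = ⌊(h²+6h+1)/4⌋`); only the easy upper bound is used and it is proved here from scratch.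
-/

-- `Summit.ValiantsHypothesis.ValiantsHypothesis.…` repeats a component by the D-0017 layout
-- (single-conjunct summit), which the `dupNamespace` linter flags; the name is mandated.
set_option linter.dupNamespace false

namespace Summit.ValiantsHypothesis.ValiantsHypothesis.Theorems.LacunarySymmetroidMatrixDescartes.FiniteSector

open scoped BigOperators Matrix
open Polynomial

/-! ## §1 The non-representable value `x(m+3−x) − 1` -/

/-- **Stöhr's witness.**  With stamps `{1, x}`, `1 ≤ x ≤ m + 2`, and at most `m` stamps, `x·(m + 3 − x) − 1` is not representable:
`p + q·x = x(m+3−x) − 1` with `p + q ≤ m` is impossible.  (If `q ≥ m + 3 − x` the `x`-stamps alone exceed the value; otherwise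
`j = m + 3 − x − q ≥ 1` and `p = j·x − 1`, so `p + q = jx + m + 2 − x − j ≥ m + 1`.) [folklore] -/
theorem stoehr_witness_not_rep (m x : ℕ) (hx1 : 1 ≤ x) (hx : x ≤ m + 2) :
    ∀ p q : ℕ, p + q ≤ m → p + q * x ≠ x * (m + 3 - x) - 1 := by
  intro p q hpq h
  -- write k = m + 3 - x ≥ 1, so x * k ≥ 1 and the subtraction is harmless
  obtain ⟨k, hk⟩ : ∃ k, k = m + 3 - x := ⟨_, rfl⟩
  have hk1 : 1 ≤ k := by omega
  have hxk : x + k = m + 3 := by omega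
  rw [← hk] at h
  have hxk1 : 1 ≤ x * k := Nat.le_trans hx1 (Nat.le_mul_of_pos_right x hk1)
  -- p + q x + 1 = x k
  have h' : p + q * x + 1 = x * k := by omega
  rcases Nat.lt_or_ge q k with hq | hq
  · -- q < k: j = k - q ≥ 1, p + 1 = x * (k - q)
    obtain ⟨j, hj⟩ : ∃ j, k = q + j := ⟨k - q, by omega⟩
    have hj1 : 1 ≤ j := by omega
    rw [hj, Nat.mul_add] at h'
    -- h' : p + q * x + 1 = x * q + x * j
    have hp : p + 1 = x * j := by
      have : x * q = q * x := Nat.mul_comm x q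
      omega
    -- x * j ≥ x + j - 1 since (x-1)(j-1) ≥ 0
    have hxj : x + j ≤ x * j + 1 := by
      obtain ⟨x', rfl⟩ : ∃ x', x = x' + 1 := ⟨x - 1, by omega⟩
      obtain ⟨j', rfl⟩ : ∃ j', j = j' + 1 := ⟨j - 1, by omega⟩
      nlinarith [Nat.zero_le (x' * j')]
    omega
  · -- q ≥ k: the x-stamps alone reach x k > x k - 1
    have : k * x ≤ q * x := Nat.mul_le_mul_right x hq
    have : x * k = k * x := Nat.mul_comm x k
    omega

/-- The size of Stöhr's witness: `4·(x(m+3−x) − 1) + 4 ≤ (m+3)²`, i.e. `4(x(m+3−x) − 1) ≤ m² + 6m + 5`. [folklore] -/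
theorem stoehr_witness_le (m x : ℕ) (hx1 : 1 ≤ x) (hx : x ≤ m + 2) :
    4 * (x * (m + 3 - x) - 1) ≤ m ^ 2 + 6 * m + 5 := by
  obtain ⟨k, hk⟩ : ∃ k, k = m + 3 - x := ⟨_, rfl⟩
  have hxk : x + k = m + 3 := by omega
  rw [← hk]
  have h4 : 4 * (x * k) ≤ (x + k) ^ 2 := by nlinarith [sq_nonneg (x - k : ℤ), sq_nonneg (x + k : ℤ)]
  rw [hxk] at h4
  have hxk1 : 1 ≤ x * k := Nat.le_trans hx1 (Nat.le_mul_of_pos_right x (by omega))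
  have : (m + 3) ^ 2 = m ^ 2 + 6 * m + 9 := by ring
  omega

/-! ## §2 The closed-form row -/

/-- **Two denominations, `m` stamps: some `r ≤ ⌊(m²+6m+1)/4⌋ + 1` is not representable** — for every second denomination `x`.
[folklore] -/
theorem stamps_two_denominations_all (m : ℕ) (hm : 1 ≤ m) (x : ℕ) :
    ∃ r, r ≤ (m ^ 2 + 6 * m + 1) / 4 + 1 ∧ ∀ p q : ℕ, p + q ≤ m → p + q * x ≠ r := by
  have hdiv : m + 1 ≤ (m ^ 2 + 6 * m + 1) / 4 + 1 := by
    have : m ≤ (m ^ 2 + 6 * m + 1) / 4 := by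
      apply (Nat.le_div_iff_mul_le (by norm_num)).2
      nlinarith
    omega
  rcases Nat.eq_zero_or_pos x with hx0 | hx1
  · -- x = 0: only the `1`-stamps count, at most `m` of them
    subst hx0
    exact ⟨m + 1, hdiv, fun p q hpq h => by omega⟩
  rcases Nat.lt_or_ge x (m + 3) with hx | hx
  · -- 1 ≤ x ≤ m + 2: Stöhr's witness
    refine ⟨x * (m + 3 - x) - 1, ?_, stoehr_witness_not_rep m x hx1 (by omega)⟩
    have h := stoehr_witness_le m x hx1 (by omega)
    have : x * (m + 3 - x) - 1 ≤ (m ^ 2 + 6 * m + 5) / 4 :=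
      (Nat.le_div_iff_mul_le (by norm_num)).2 (by omega)
    have h45 : (m ^ 2 + 6 * m + 5) / 4 = (m ^ 2 + 6 * m + 1) / 4 + 1 := by omega
    omega
  · -- x ≥ m + 3: `m + 1` is not representable
    refine ⟨m + 1, hdiv, fun p q hpq h => ?_⟩
    rcases Nat.eq_zero_or_pos q with hq | hq
    · subst hq; omega
    · have : x ≤ q * x := Nat.le_mul_of_pos_left x hq
      omega

/-- **STÖHR'S CEILING for the `K = 3` column, all sizes (kernel): `ν(m,3) ≤ n(m,2) = ⌊(m²+6m+1)/4⌋`** — every full-positive-rooted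
determinant of a real symmetric `m × m` half-pencil with three terms has degree `≤ ⌊(m²+6m+1)/4⌋`, for ALL supports `d : Fin 3 → ℕ`
and all `m ≥ 1`.  (`m = 3,4,5`: `7, 10, 14`, realised — `…FiniteSectorRealisable`, `…RealisableKThree`; `m = 6,7,8,…`: `18, 23, 28, …`.)
[folklore] -/
theorem stampLawAt_K_three (m : ℕ) (hm : 1 ≤ m) : StampLawAt m 3 ((m ^ 2 + 6 * m + 1) / 4) :=
  stampLawAt_three_of_stamps hm (stamps_two_denominations_all m hm)

/-- Sanity instances of the closed form: the numeric rows of `…StampCeilingKThree` are special cases. [folklore] -/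
theorem stampLawAt_K_three_examples :
    StampLawAt 3 3 7 ∧ StampLawAt 4 3 10 ∧ StampLawAt 5 3 14 ∧ StampLawAt 8 3 28 ∧ StampLawAt 10 3 40 :=
  ⟨stampLawAt_K_three 3 (by norm_num), stampLawAt_K_three 4 (by norm_num), stampLawAt_K_three 5 (by norm_num),
    stampLawAt_K_three 8 (by norm_num), stampLawAt_K_three 10 (by norm_num)⟩

end Summit.ValiantsHypothesis.ValiantsHypothesis.Theorems.LacunarySymmetroidMatrixDescartes.FiniteSector
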